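import Summits.QuantumFields.YangMills.Theorems.AllWindowsColdBoxBoxHighLineTiltSecondOrder

/-!
# U5-L3a, generic layer: THIRD-ORDER calculus of the exponential tilt — the fifth joint cumulant and `TiltThirdOrder`

Continuation of ✓`…TiltSecondOrder` (T-S5.13t, seat fcl-p3 g25) one order up, for the recorded lift **L3** of planner ym-idea-2 g18's
`Cruxes/BoxWindowHighSU2213/U5-BLOCKERS.md` §2 («third-order tilt expansion `f(1) = f(0) + f′(0) + f″(0)/2 + ∫₀¹ (1−t)²/2·f‴(t) dt` with
`f″(0) = κ₄,₀` evaluated exactly and only `f‴ = κ₅,t` by Cauchy–Schwarz + norm transfer»; «New typed items: `Tilt.tiltCum5`, Prop `TiltThirdOrder`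
(abstract, like 13t)»).  For a finite non-zero measure `μ` and bounded measurable `U, G₁, G₂`:

* `Tilt.tiltCum5 μ U t G₁ G₂` — the FIFTH joint cumulant `κ₅,t(G₁,G₂,U,U,U) = E_t[G̃₁G̃₂Ũ³] − E_t[G̃₁G̃₂]·E_t[Ũ³] − 3E_t[G̃₁Ũ]·E_t[G̃₂Ũ²]
  − 3E_t[G̃₂Ũ]·E_t[G̃₁Ũ²] − 3E_t[Ũ²]·E_t[G̃₁G̃₂Ũ]` (centred at `t`; the ten pair|triple splits of `{G₁,G₂,U,U,U}`);
* `tiltCum4_eq_raw` (raw-moment expansion of `κ₄,t`), re-centring invariances `tiltCum5_shift` / `tiltCum5_shiftU`;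
* ★ **`Tilt.hasDerivAt_tiltCum4`**: `d/dt κ₄,t(G₁,G₂,U,U) = κ₅,t(G₁,G₂,U,U,U)` at every `t₀` (centred case by the product rule on the raw
  expansion, general case by re-centring at `t₀` — the pattern of ✓`hasDerivAt_tiltCum3`);
* `abs_sub_sub_sub_le_of_third_deriv`: `|f 1 − f 0 − f′ 0 − f″ 0 / 2| ≤ K/6` from `|f‴| ≤ K` on `[0,1]`;
* ★★ the Prop **`TiltThirdOrder`** (13t's shape one order up) and its proof **`tiltThirdOrder`**:
  `|Cov₁(G₁,G₂) − Cov₀(G₁,G₂) − κ₃,₀ − κ₄,₀/2| ≤ K/6` whenever `|κ₅,t(G₁,G₂,U,U,U)| ≤ K` on `[0,1]`.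

Tree + Mathlib; standard axioms; two definitions (`Tilt.tiltCum5`, `TiltThirdOrder`).
HONEST LABEL: abstract measure-theoretic support for the recorded lift L3 of the NEXT rung U5 (LINE-20 ⟨stmt-QuantumFields-24336⟩, unstaffed);
S5/U5, ⟨24004⟩ ⟨24335⟩ ⟨24336⟩ and route AllWindowsColdBox (DRAFT) remain OPEN; the Yang–Mills mass gap is NOT proved by this file; no summit is
proved by a line.  Seat ym-line-fcl-p3 g26.
-/

set_option autoImplicit false

noncomputable section

open MeasureTheory Set
open Summit.QuantumFields.YangMills.Cruxes.NT.SkewResponse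

namespace Summit.QuantumFields.YangMills.Theorems.AllWindowsColdBoxBoxHighLine

namespace Tilt

/-! ## §1 Bounds of powers and products of bounded observables -/

section Bounds

variable {Ω : Type*}

/-- `|X^n| ≤ M^n`. -/
theorem abs_pow_le_pow {X : Ω → ℝ} {M : ℝ} (hX : ∀ x, |X x| ≤ M) (n : ℕ) (x : Ω) : |X x ^ n| ≤ M ^ n := by
  rw [abs_pow]; exact pow_le_pow_left₀ (abs_nonneg _) (hX x) n

/-- `|X · W^n| ≤ MX · MW^n`. -/
theorem abs_mul_pow_le {X W : Ω → ℝ} {MX MW : ℝ} (hX : ∀ x, |X x| ≤ MX) (hW : ∀ x, |W x| ≤ MW) (n : ℕ) (x : Ω) :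
    |X x * W x ^ n| ≤ MX * MW ^ n :=
  abs_mul_le_mul (Y := fun x => W x ^ n) hX (abs_pow_le_pow hW n) x

/-- `|X · Y · W^n| ≤ MX · MY · MW^n`. -/
theorem abs_mul_mul_pow_le {X Y W : Ω → ℝ} {MX MY MW : ℝ} (hX : ∀ x, |X x| ≤ MX) (hY : ∀ x, |Y x| ≤ MY)
    (hW : ∀ x, |W x| ≤ MW) (n : ℕ) (x : Ω) : |X x * Y x * W x ^ n| ≤ MX * MY * MW ^ n :=
  abs_mul_le_mul (X := fun x => X x * Y x) (Y := fun x => W x ^ n) (abs_mul_le_mul hX hY) (abs_pow_le_pow hW n) x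

end Bounds

variable {Ω : Type*} [MeasurableSpace Ω] {μ : Measure Ω}

/-! ## §2 The fifth joint cumulant along the tilt -/

/-- Fifth joint cumulant `κ₅,t(G₁,G₂,U,U,U) = E_t[G̃₁G̃₂Ũ³] − E_t[G̃₁G̃₂]·E_t[Ũ³] − 3·E_t[G̃₁Ũ]·E_t[G̃₂Ũ²] − 3·E_t[G̃₂Ũ]·E_t[G̃₁Ũ²]
− 3·E_t[Ũ²]·E_t[G̃₁G̃₂Ũ]` (all variables centred at `t`) — the third `t`-derivative of `Cov_t(G₁,G₂)`, i.e. the `t`-derivative of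
`Tilt.tiltCum4` (`hasDerivAt_tiltCum4`). -/
def tiltCum5 (μ : Measure Ω) (U : Ω → ℝ) (t : ℝ) (G₁ G₂ : Ω → ℝ) : ℝ :=
  tiltExp μ U t (fun x => (G₁ x - tiltExp μ U t G₁) * (G₂ x - tiltExp μ U t G₂) * (U x - tiltExp μ U t U) ^ 3) -
    tiltExp μ U t (fun x => (G₁ x - tiltExp μ U t G₁) * (G₂ x - tiltExp μ U t G₂)) *
      tiltExp μ U t (fun x => (U x - tiltExp μ U t U) ^ 3) -
    3 * (tiltExp μ U t (fun x => (G₁ x - tiltExp μ U t G₁) * (U x - tiltExp μ U t U)) *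
      tiltExp μ U t (fun x => (G₂ x - tiltExp μ U t G₂) * (U x - tiltExp μ U t U) ^ 2)) -
    3 * (tiltExp μ U t (fun x => (G₂ x - tiltExp μ U t G₂) * (U x - tiltExp μ U t U)) *
      tiltExp μ U t (fun x => (G₁ x - tiltExp μ U t G₁) * (U x - tiltExp μ U t U) ^ 2)) -
    3 * (tiltExp μ U t (fun x => (U x - tiltExp μ U t U) ^ 2) *
      tiltExp μ U t (fun x => (G₁ x - tiltExp μ U t G₁) * (G₂ x - tiltExp μ U t G₂) * (U x - tiltExp μ U t U)))

/-! ## §3 Raw-moment expansions -/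

/-- `E_t[(W − a)²] = E_t[W²] − 2a·E_t[W] + a²`. [folklore] -/
theorem tiltExp_sub_sq [IsFiniteMeasure μ] [NeZero μ] {U W : Ω → ℝ} {BU BW : ℝ} (hU : Measurable U) (hW : Measurable W)
    (hUb : ∀ x, |U x| ≤ BU) (hWb : ∀ x, |W x| ≤ BW) (a t : ℝ) :
    tiltExp μ U t (fun x => (W x - a) ^ 2) = tiltExp μ U t (fun x => W x ^ 2) - 2 * a * tiltExp μ U t W + a ^ 2 := by
  have e : (fun x => (W x - a) ^ 2) = fun x => (W x - a) * (W x - a) := by funext x; ring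
  have e' : (fun x => W x * W x) = fun x => W x ^ 2 := by funext x; ring
  rw [e, tiltExp_sub_mul_sub hU hW hW hUb hWb hWb, e']
  ring

/-- `E_t[(W₁ − a)(W₂ − b)(U − c)²]` in raw moments (twelve terms). [folklore] -/
theorem tiltExp_sub_mul_sub_mul_sub_sq [IsFiniteMeasure μ] [NeZero μ] {U W₁ W₂ : Ω → ℝ} {BU B₁ B₂ : ℝ} (hU : Measurable U)
    (h₁ : Measurable W₁) (h₂ : Measurable W₂) (hUb : ∀ x, |U x| ≤ BU) (h₁b : ∀ x, |W₁ x| ≤ B₁) (h₂b : ∀ x, |W₂ x| ≤ B₂)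
    (a b c t : ℝ) :
    tiltExp μ U t (fun x => (W₁ x - a) * (W₂ x - b) * (U x - c) ^ 2) =
      tiltExp μ U t (fun x => W₁ x * W₂ x * U x ^ 2) - 2 * c * tiltExp μ U t (fun x => W₁ x * W₂ x * U x)
        + c ^ 2 * tiltExp μ U t (fun x => W₁ x * W₂ x)
        - a * tiltExp μ U t (fun x => W₂ x * U x ^ 2) + 2 * a * c * tiltExp μ U t (fun x => W₂ x * U x)
        - a * c ^ 2 * tiltExp μ U t W₂
        - b * tiltExp μ U t (fun x => W₁ x * U x ^ 2) + 2 * b * c * tiltExp μ U t (fun x => W₁ x * U x)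
        - b * c ^ 2 * tiltExp μ U t W₁
        + a * b * tiltExp μ U t (fun x => U x ^ 2) - 2 * a * b * c * tiltExp μ U t U + a * b * c ^ 2 := by
  haveI := isProbabilityMeasure_tilted_mul (μ := μ) hU hUb t
  simp only [tiltExp_eq_integral_tilted]
  set ν := μ.tilted fun x => t * U x
  -- the twelve integrable monomials
  have i1 : Integrable (fun x => W₁ x * W₂ x * U x ^ 2) ν :=
    integrable_of_abs_le ((h₁.mul h₂).mul (hU.pow_const 2)) (abs_mul_mul_pow_le h₁b h₂b hUb 2)
  have i2 : Integrable (fun x => 2 * c * (W₁ x * W₂ x * U x)) ν :=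
    (integrable_of_abs_le ((h₁.mul h₂).mul hU) (abs_mul_mul_le h₁b h₂b hUb)).const_mul _
  have i3 : Integrable (fun x => c ^ 2 * (W₁ x * W₂ x)) ν :=
    (integrable_of_abs_le (h₁.mul h₂) (abs_mul_le_mul h₁b h₂b)).const_mul _
  have i4 : Integrable (fun x => a * (W₂ x * U x ^ 2)) ν :=
    (integrable_of_abs_le (h₂.mul (hU.pow_const 2)) (abs_mul_pow_le h₂b hUb 2)).const_mul _
  have i5 : Integrable (fun x => 2 * a * c * (W₂ x * U x)) ν :=
    (integrable_of_abs_le (h₂.mul hU) (abs_mul_le_mul h₂b hUb)).const_mul _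
  have i6 : Integrable (fun x => a * c ^ 2 * W₂ x) ν := (integrable_of_abs_le h₂ h₂b).const_mul _
  have i7 : Integrable (fun x => b * (W₁ x * U x ^ 2)) ν :=
    (integrable_of_abs_le (h₁.mul (hU.pow_const 2)) (abs_mul_pow_le h₁b hUb 2)).const_mul _
  have i8 : Integrable (fun x => 2 * b * c * (W₁ x * U x)) ν :=
    (integrable_of_abs_le (h₁.mul hU) (abs_mul_le_mul h₁b hUb)).const_mul _
  have i9 : Integrable (fun x => b * c ^ 2 * W₁ x) ν := (integrable_of_abs_le h₁ h₁b).const_mul _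
  have i10 : Integrable (fun x => a * b * U x ^ 2) ν :=
    (integrable_of_abs_le (hU.pow_const 2) (abs_pow_le_pow hUb 2)).const_mul _
  have i11 : Integrable (fun x => 2 * a * b * c * U x) ν := (integrable_of_abs_le hU hUb).const_mul _
  have e : (fun x => (W₁ x - a) * (W₂ x - b) * (U x - c) ^ 2) = fun x =>
      W₁ x * W₂ x * U x ^ 2 - 2 * c * (W₁ x * W₂ x * U x) + c ^ 2 * (W₁ x * W₂ x)
        - a * (W₂ x * U x ^ 2) + 2 * a * c * (W₂ x * U x) - a * c ^ 2 * W₂ x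
        - b * (W₁ x * U x ^ 2) + 2 * b * c * (W₁ x * U x) - b * c ^ 2 * W₁ x
        + a * b * U x ^ 2 - 2 * a * b * c * U x + a * b * c ^ 2 := by
    funext x; ring
  rw [e]
  have s2 : Integrable (fun x => W₁ x * W₂ x * U x ^ 2 - 2 * c * (W₁ x * W₂ x * U x)) ν := i1.sub i2
  have s3 : Integrable (fun x => W₁ x * W₂ x * U x ^ 2 - 2 * c * (W₁ x * W₂ x * U x) + c ^ 2 * (W₁ x * W₂ x)) ν := s2.add i3
  have s4 : Integrable (fun x => W₁ x * W₂ x * U x ^ 2 - 2 * c * (W₁ x * W₂ x * U x) + c ^ 2 * (W₁ x * W₂ x) - a * (W₂ x * U x ^ 2)) ν := s3.sub i4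
  have s5 : Integrable (fun x => W₁ x * W₂ x * U x ^ 2 - 2 * c * (W₁ x * W₂ x * U x) + c ^ 2 * (W₁ x * W₂ x) - a * (W₂ x * U x ^ 2) + 2 * a * c * (W₂ x * U x)) ν := s4.add i5
  have s6 : Integrable (fun x => W₁ x * W₂ x * U x ^ 2 - 2 * c * (W₁ x * W₂ x * U x) + c ^ 2 * (W₁ x * W₂ x) - a * (W₂ x * U x ^ 2) + 2 * a * c * (W₂ x * U x) - a * c ^ 2 * W₂ x) ν := s5.sub i6
  have s7 : Integrable (fun x => W₁ x * W₂ x * U x ^ 2 - 2 * c * (W₁ x * W₂ x * U x) + c ^ 2 * (W₁ x * W₂ x) - a * (W₂ x * U x ^ 2) + 2 * a * c * (W₂ x * U x) - a * c ^ 2 * W₂ x - b * (W₁ x * U x ^ 2)) ν := s6.sub i7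
  have s8 : Integrable (fun x => W₁ x * W₂ x * U x ^ 2 - 2 * c * (W₁ x * W₂ x * U x) + c ^ 2 * (W₁ x * W₂ x) - a * (W₂ x * U x ^ 2) + 2 * a * c * (W₂ x * U x) - a * c ^ 2 * W₂ x - b * (W₁ x * U x ^ 2) + 2 * b * c * (W₁ x * U x)) ν := s7.add i8
  have s9 : Integrable (fun x => W₁ x * W₂ x * U x ^ 2 - 2 * c * (W₁ x * W₂ x * U x) + c ^ 2 * (W₁ x * W₂ x) - a * (W₂ x * U x ^ 2) + 2 * a * c * (W₂ x * U x) - a * c ^ 2 * W₂ x - b * (W₁ x * U x ^ 2) + 2 * b * c * (W₁ x * U x) - b * c ^ 2 * W₁ x) ν := s8.sub i9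
  have s10 : Integrable (fun x => W₁ x * W₂ x * U x ^ 2 - 2 * c * (W₁ x * W₂ x * U x) + c ^ 2 * (W₁ x * W₂ x) - a * (W₂ x * U x ^ 2) + 2 * a * c * (W₂ x * U x) - a * c ^ 2 * W₂ x - b * (W₁ x * U x ^ 2) + 2 * b * c * (W₁ x * U x) - b * c ^ 2 * W₁ x + a * b * U x ^ 2) ν := s9.add i10
  have s11 : Integrable (fun x => W₁ x * W₂ x * U x ^ 2 - 2 * c * (W₁ x * W₂ x * U x) + c ^ 2 * (W₁ x * W₂ x) - a * (W₂ x * U x ^ 2) + 2 * a * c * (W₂ x * U x) - a * c ^ 2 * W₂ x - b * (W₁ x * U x ^ 2) + 2 * b * c * (W₁ x * U x) - b * c ^ 2 * W₁ x + a * b * U x ^ 2 - 2 * a * b * c * U x) ν := s10.sub i11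
  rw [integral_add s11 (integrable_const _), integral_sub s10 i11, integral_add s9 i10, integral_sub s8 i9, integral_add s7 i8,
    integral_sub s6 i7, integral_sub s5 i6, integral_add s4 i5, integral_sub s3 i4, integral_add s2 i3, integral_sub i1 i2,
    integral_const_mul, integral_const_mul, integral_const_mul, integral_const_mul, integral_const_mul, integral_const_mul,
    integral_const_mul, integral_const_mul, integral_const_mul, integral_const_mul]
  simp only [integral_const, measure_univ, ENNReal.toReal_one, smul_eq_mul, Measure.real, one_mul]

/-- The raw-moment expansion of the fourth cumulant (`m₁ = E_t[W₁]`, `m₂ = E_t[W₂]`, `u = E_t[U]`):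
`κ₄,t = E[W₁W₂U²] − 2u·E[W₁W₂U] + 2u²·E[W₁W₂] − m₁·E[W₂U²] − m₂·E[W₁U²] + 4m₁u·E[W₂U] + 4m₂u·E[W₁U] + 2m₁m₂·E[U²] − 6m₁m₂u²
− E[W₁W₂]·E[U²] − 2·E[W₁U]·E[W₂U]`. [folklore] -/
theorem tiltCum4_eq_raw [IsFiniteMeasure μ] [NeZero μ] {U W₁ W₂ : Ω → ℝ} {BU B₁ B₂ : ℝ} (hU : Measurable U)
    (h₁ : Measurable W₁) (h₂ : Measurable W₂) (hUb : ∀ x, |U x| ≤ BU) (h₁b : ∀ x, |W₁ x| ≤ B₁) (h₂b : ∀ x, |W₂ x| ≤ B₂)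
    (t : ℝ) :
    tiltCum4 μ U t W₁ W₂ =
      tiltExp μ U t (fun x => W₁ x * W₂ x * U x ^ 2)
        - 2 * tiltExp μ U t U * tiltExp μ U t (fun x => W₁ x * W₂ x * U x)
        + 2 * tiltExp μ U t U ^ 2 * tiltExp μ U t (fun x => W₁ x * W₂ x)
        - tiltExp μ U t W₁ * tiltExp μ U t (fun x => W₂ x * U x ^ 2)
        - tiltExp μ U t W₂ * tiltExp μ U t (fun x => W₁ x * U x ^ 2)
        + 4 * (tiltExp μ U t W₁ * tiltExp μ U t U * tiltExp μ U t (fun x => W₂ x * U x))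
        + 4 * (tiltExp μ U t W₂ * tiltExp μ U t U * tiltExp μ U t (fun x => W₁ x * U x))
        + 2 * (tiltExp μ U t W₁ * tiltExp μ U t W₂ * tiltExp μ U t (fun x => U x ^ 2))
        - 6 * (tiltExp μ U t W₁ * tiltExp μ U t W₂ * tiltExp μ U t U ^ 2)
        - tiltExp μ U t (fun x => W₁ x * W₂ x) * tiltExp μ U t (fun x => U x ^ 2)
        - 2 * (tiltExp μ U t (fun x => W₁ x * U x) * tiltExp μ U t (fun x => W₂ x * U x)) := by
  unfold tiltCum4
  rw [tiltExp_sub_mul_sub_mul_sub_sq hU h₁ h₂ hUb h₁b h₂b, tiltExp_sub_mul_sub hU h₁ h₂ hUb h₁b h₂b,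
    tiltExp_sub_sq hU hU hUb hUb, tiltExp_sub_mul_sub hU h₁ hU hUb h₁b hUb, tiltExp_sub_mul_sub hU h₂ hU hUb h₂b hUb]
  ring

/-! ## §4 Re-centring invariances of the fifth cumulant -/

/-- The fifth cumulant is invariant under constant shifts of the observables. [folklore] -/
theorem tiltCum5_shift [IsFiniteMeasure μ] [NeZero μ] {U W₁ W₂ : Ω → ℝ} {BU B₁ B₂ : ℝ} (hU : Measurable U)
    (h₁ : Measurable W₁) (h₂ : Measurable W₂) (hUb : ∀ x, |U x| ≤ BU) (h₁b : ∀ x, |W₁ x| ≤ B₁) (h₂b : ∀ x, |W₂ x| ≤ B₂)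
    (a b t : ℝ) :
    tiltCum5 μ U t (fun x => W₁ x - a) (fun x => W₂ x - b) = tiltCum5 μ U t W₁ W₂ := by
  unfold tiltCum5
  rw [tiltExp_sub_const hU h₁ hUb h₁b, tiltExp_sub_const hU h₂ hUb h₂b]
  simp only [sub_sub_sub_cancel_right]

/-- The fifth cumulant is invariant under a constant shift of the tilt observable. [folklore] -/
theorem tiltCum5_shiftU [IsFiniteMeasure μ] [NeZero μ] {U : Ω → ℝ} {BU : ℝ} (hU : Measurable U) (hUb : ∀ x, |U x| ≤ BU)
    (c t : ℝ) (W₁ W₂ : Ω → ℝ) :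
    tiltCum5 μ (fun x => U x - c) t W₁ W₂ = tiltCum5 μ U t W₁ W₂ := by
  unfold tiltCum5
  simp only [tiltExp_shiftU]
  rw [tiltExp_sub_const hU hU hUb hUb]
  simp only [sub_sub_sub_cancel_right]

/-! ## §5 `d/dt κ₄,t = κ₅,t` -/

/-- Centred case: `d/dt|_{t₀} κ₄,t = κ₅,t₀` when `E_{t₀}[W₁] = E_{t₀}[W₂] = E_{t₀}[U] = 0` (product rule on `tiltCum4_eq_raw`). [folklore] -/
theorem hasDerivAt_tiltCum4_centred [IsFiniteMeasure μ] [NeZero μ] {U W₁ W₂ : Ω → ℝ} {BU B₁ B₂ : ℝ} (hU : Measurable U)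
    (h₁ : Measurable W₁) (h₂ : Measurable W₂) (hUb : ∀ x, |U x| ≤ BU) (h₁b : ∀ x, |W₁ x| ≤ B₁) (h₂b : ∀ x, |W₂ x| ≤ B₂)
    {t₀ : ℝ} (hm₁ : tiltExp μ U t₀ W₁ = 0) (hm₂ : tiltExp μ U t₀ W₂ = 0) (hu : tiltExp μ U t₀ U = 0) :
    HasDerivAt (fun t => tiltCum4 μ U t W₁ W₂) (tiltCum5 μ U t₀ W₁ W₂) t₀ := by
  have e : (fun t => tiltCum4 μ U t W₁ W₂) = fun t =>
      tiltExp μ U t (fun x => W₁ x * W₂ x * U x ^ 2)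
        - 2 * tiltExp μ U t U * tiltExp μ U t (fun x => W₁ x * W₂ x * U x)
        + 2 * tiltExp μ U t U ^ 2 * tiltExp μ U t (fun x => W₁ x * W₂ x)
        - tiltExp μ U t W₁ * tiltExp μ U t (fun x => W₂ x * U x ^ 2)
        - tiltExp μ U t W₂ * tiltExp μ U t (fun x => W₁ x * U x ^ 2)
        + 4 * (tiltExp μ U t W₁ * tiltExp μ U t U * tiltExp μ U t (fun x => W₂ x * U x))
        + 4 * (tiltExp μ U t W₂ * tiltExp μ U t U * tiltExp μ U t (fun x => W₁ x * U x))
        + 2 * (tiltExp μ U t W₁ * tiltExp μ U t W₂ * tiltExp μ U t (fun x => U x ^ 2))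
        - 6 * (tiltExp μ U t W₁ * tiltExp μ U t W₂ * tiltExp μ U t U ^ 2)
        - tiltExp μ U t (fun x => W₁ x * W₂ x) * tiltExp μ U t (fun x => U x ^ 2)
        - 2 * (tiltExp μ U t (fun x => W₁ x * U x) * tiltExp μ U t (fun x => W₂ x * U x)) := by
    funext t; exact tiltCum4_eq_raw hU h₁ h₂ hUb h₁b h₂b t
  rw [e]
  -- derivatives of the eleven raw moments
  have d12UU := hasDerivAt_tiltExp (μ := μ) (W := fun x => W₁ x * W₂ x * U x ^ 2) hU ((h₁.mul h₂).mul (hU.pow_const 2)) hUb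
    (abs_mul_mul_pow_le h₁b h₂b hUb 2) t₀
  have d12U := hasDerivAt_tiltExp (μ := μ) (W := fun x => W₁ x * W₂ x * U x) hU ((h₁.mul h₂).mul hU) hUb
    (abs_mul_mul_le h₁b h₂b hUb) t₀
  have d12 := hasDerivAt_tiltExp (μ := μ) (W := fun x => W₁ x * W₂ x) hU (h₁.mul h₂) hUb (abs_mul_le_mul h₁b h₂b) t₀
  have d2UU := hasDerivAt_tiltExp (μ := μ) (W := fun x => W₂ x * U x ^ 2) hU (h₂.mul (hU.pow_const 2)) hUb
    (abs_mul_pow_le h₂b hUb 2) t₀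
  have d1UU := hasDerivAt_tiltExp (μ := μ) (W := fun x => W₁ x * U x ^ 2) hU (h₁.mul (hU.pow_const 2)) hUb
    (abs_mul_pow_le h₁b hUb 2) t₀
  have d2U := hasDerivAt_tiltExp (μ := μ) (W := fun x => W₂ x * U x) hU (h₂.mul hU) hUb (abs_mul_le_mul h₂b hUb) t₀
  have d1U := hasDerivAt_tiltExp (μ := μ) (W := fun x => W₁ x * U x) hU (h₁.mul hU) hUb (abs_mul_le_mul h₁b hUb) t₀
  have dUU := hasDerivAt_tiltExp (μ := μ) (W := fun x => U x ^ 2) hU (hU.pow_const 2) hUb (abs_pow_le_pow hUb 2) t₀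
  have d1 := hasDerivAt_tiltExp (μ := μ) hU h₁ hUb h₁b t₀
  have d2 := hasDerivAt_tiltExp (μ := μ) hU h₂ hUb h₂b t₀
  have dU := hasDerivAt_tiltExp (μ := μ) hU hU hUb hUb t₀
  have dUsq := dU.pow 2
  have key := ((((((((((d12UU.sub ((dU.const_mul 2).mul d12U)).add ((dUsq.const_mul 2).mul d12)).sub (d1.mul d2UU)).sub
    (d2.mul d1UU)).add (((d1.mul dU).mul d2U).const_mul 4)).add (((d2.mul dU).mul d1U).const_mul 4)).add
    (((d1.mul d2).mul dUU).const_mul 2)).sub (((d1.mul d2).mul dUsq).const_mul 6)).sub (d12.mul dUU)).sub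
    ((d1U.mul d2U).const_mul 2))
  refine key.congr_deriv ?_
  unfold tiltCum5
  simp only [Pi.mul_apply, Pi.pow_apply, hm₁, hm₂, hu, sub_zero, zero_mul, mul_zero, add_zero, pow_two,
    Nat.cast_ofNat]
  have f1 : (fun x => W₁ x * W₂ x * (U x * U x) * U x) = fun x => W₁ x * W₂ x * U x ^ 3 := by funext x; ring
  have f3 : (fun x => U x * U x * U x) = fun x => U x ^ 3 := by funext x; ring
  have f4 : (fun x => U x * U x) = fun x => U x ^ 2 := by funext x; ring
  have f5 : (fun x => W₁ x * (U x * U x)) = fun x => W₁ x * U x ^ 2 := by funext x; ring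
  have f6 : (fun x => W₂ x * (U x * U x)) = fun x => W₂ x * U x ^ 2 := by funext x; ring
  have f7 : (fun x => W₁ x * U x * U x) = fun x => W₁ x * U x ^ 2 := by funext x; ring
  have f8 : (fun x => W₂ x * U x * U x) = fun x => W₂ x * U x ^ 2 := by funext x; ring
  simp only [f1, f3, f4, f5, f6, f7, f8]
  ring

/-- **`d/dt κ₄,t(G₁,G₂,U,U) = κ₅,t(G₁,G₂,U,U,U)`** at every `t₀` (bounded measurable data, finite non-zero `μ`). [folklore] -/
theorem hasDerivAt_tiltCum4 [IsFiniteMeasure μ] [NeZero μ] {U G₁ G₂ : Ω → ℝ} {BU B₁ B₂ : ℝ} (hU : Measurable U)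
    (h₁ : Measurable G₁) (h₂ : Measurable G₂) (hUb : ∀ x, |U x| ≤ BU) (h₁b : ∀ x, |G₁ x| ≤ B₁) (h₂b : ∀ x, |G₂ x| ≤ B₂)
    (t₀ : ℝ) : HasDerivAt (fun t => tiltCum4 μ U t G₁ G₂) (tiltCum5 μ U t₀ G₁ G₂) t₀ := by
  set a := tiltExp μ U t₀ G₁
  set b := tiltExp μ U t₀ G₂
  set c := tiltExp μ U t₀ U
  have hV : Measurable fun x => U x - c := hU.sub measurable_const
  have hW₁ : Measurable fun x => G₁ x - a := h₁.sub measurable_const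
  have hW₂ : Measurable fun x => G₂ x - b := h₂.sub measurable_const
  have hVb : ∀ x, |U x - c| ≤ BU + |c| := fun x => (abs_sub _ _).trans (by linarith [hUb x])
  have hW₁b : ∀ x, |G₁ x - a| ≤ B₁ + |a| := fun x => (abs_sub _ _).trans (by linarith [h₁b x])
  have hW₂b : ∀ x, |G₂ x - b| ≤ B₂ + |b| := fun x => (abs_sub _ _).trans (by linarith [h₂b x])
  have e : (fun t => tiltCum4 μ U t G₁ G₂) = fun t => tiltCum4 μ (fun x => U x - c) t (fun x => G₁ x - a) (fun x => G₂ x - b) := by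
    funext t
    rw [tiltCum4_shiftU hU hUb, tiltCum4_shift hU h₁ h₂ hUb h₁b h₂b]
  have e5 : tiltCum5 μ U t₀ G₁ G₂ = tiltCum5 μ (fun x => U x - c) t₀ (fun x => G₁ x - a) (fun x => G₂ x - b) := by
    rw [tiltCum5_shiftU hU hUb, tiltCum5_shift hU h₁ h₂ hUb h₁b h₂b]
  rw [e, e5]
  refine hasDerivAt_tiltCum4_centred hV hW₁ hW₂ hVb hW₁b hW₂b ?_ ?_ ?_
  · rw [tiltExp_shiftU, tiltExp_sub_const hU h₁ hUb h₁b]; exact sub_self a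
  · rw [tiltExp_shiftU, tiltExp_sub_const hU h₂ hUb h₂b]; exact sub_self b
  · rw [tiltExp_shiftU, tiltExp_sub_const hU hU hUb hUb]; exact sub_self c

/-! ## §6 Third-order Taylor bound on `[0,1]` -/

/-- `|f 1 − f 0 − f′ 0 − f″ 0 / 2| ≤ K/6` for a thrice differentiable `f : ℝ → ℝ` with `|f‴| ≤ K` on `[0,1]`. [folklore] -/
theorem abs_sub_sub_sub_le_of_third_deriv {f f₁ f₂ f₃ : ℝ → ℝ} (hf : ∀ t, HasDerivAt f (f₁ t) t)
    (hf₁ : ∀ t, HasDerivAt f₁ (f₂ t) t) (hf₂ : ∀ t, HasDerivAt f₂ (f₃ t) t) {K : ℝ}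
    (hK : ∀ t ∈ Icc (0 : ℝ) 1, |f₃ t| ≤ K) :
    |f 1 - f 0 - f₁ 0 - f₂ 0 / 2| ≤ K / 6 := by
  -- `|f″ t − f″ 0| ≤ K t` on `[0,1]`
  have h1 : ∀ t ∈ Icc (0 : ℝ) 1, ‖f₂ t - f₂ 0‖ ≤ K * (t - 0) := by
    refine norm_image_sub_le_of_norm_deriv_right_le_segment (f := f₂) (f' := f₃)
      (fun t _ => (hf₂ t).continuousAt.continuousWithinAt) (fun t _ => (hf₂ t).hasDerivWithinAt) ?_
    intro t ht
    rw [Real.norm_eq_abs]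
    exact hK t ⟨ht.1, ht.2.le⟩
  -- `g₁ t = f′ t − f′ 0 − t f″ 0`, `g₁′ = f″ t − f″ 0`, `‖g₁ t‖ ≤ K t²/2`
  have hg1 : ∀ t, HasDerivAt (fun t => f₁ t - f₁ 0 - t * f₂ 0) (f₂ t - f₂ 0) t := by
    intro t
    have h := (hasDerivAt_id t).mul_const (f₂ 0)
    rw [one_mul] at h
    exact ((hf₁ t).sub_const (f₁ 0)).sub h
  have hB1 : ∀ t, HasDerivAt (fun t : ℝ => K * t ^ 2 / 2) (K * t) t := by
    intro t
    have := ((hasDerivAt_pow 2 t).const_mul K).div_const 2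
    refine this.congr_deriv ?_
    push_cast
    ring
  have h2 := image_norm_le_of_norm_deriv_right_le_deriv_boundary (f := fun t => f₁ t - f₁ 0 - t * f₂ 0)
    (f' := fun t => f₂ t - f₂ 0) (a := 0) (b := 1)
    (fun t _ => (hg1 t).continuousAt.continuousWithinAt) (fun t _ => (hg1 t).hasDerivWithinAt)
    (B := fun t => K * t ^ 2 / 2) (B' := fun t => K * t) (by simp) hB1
    (fun t ht => by have := h1 t ⟨ht.1, ht.2.le⟩; simpa using this)
  -- `g₂ t = f t − f 0 − t f′ 0 − t²/2 · f″ 0`, `g₂′ = g₁`, `‖g₂ t‖ ≤ K t³/6`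
  have hg2 : ∀ t, HasDerivAt (fun t => f t - f 0 - t * f₁ 0 - t ^ 2 / 2 * f₂ 0) (f₁ t - f₁ 0 - t * f₂ 0) t := by
    intro t
    have ha := (hasDerivAt_id t).mul_const (f₁ 0)
    have hb := (((hasDerivAt_pow 2 t).div_const 2).mul_const (f₂ 0))
    have := (((hf t).sub_const (f 0)).sub ha).sub hb
    refine this.congr_deriv ?_
    simp only [one_mul, Nat.cast_ofNat]
    ring
  have hB2 : ∀ t, HasDerivAt (fun t : ℝ => K * t ^ 3 / 6) (K * t ^ 2 / 2) t := by
    intro t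
    have := ((hasDerivAt_pow 3 t).const_mul K).div_const 6
    refine this.congr_deriv ?_
    push_cast
    ring
  have h3 := image_norm_le_of_norm_deriv_right_le_deriv_boundary (f := fun t => f t - f 0 - t * f₁ 0 - t ^ 2 / 2 * f₂ 0)
    (f' := fun t => f₁ t - f₁ 0 - t * f₂ 0) (a := 0) (b := 1)
    (fun t _ => (hg2 t).continuousAt.continuousWithinAt) (fun t _ => (hg2 t).hasDerivWithinAt)
    (B := fun t => K * t ^ 3 / 6) (B' := fun t => K * t ^ 2 / 2) (by simp) hB2
    (fun t ht => h2 ⟨ht.1, ht.2.le⟩)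
  have h4 := h3 (x := 1) ⟨zero_le_one, le_rfl⟩
  simp only [Real.norm_eq_abs, one_mul, one_pow, mul_one] at h4
  have e : f 1 - f 0 - f₁ 0 - f₂ 0 / 2 = f 1 - f 0 - f₁ 0 - 1 / 2 * f₂ 0 := by ring
  rw [e]
  exact h4

end Tilt

/-! ## §7 The Prop `TiltThirdOrder` and its proof -/

/-- **U5-L3 `TiltThirdOrder`** — third-order Taylor bound for a tilted covariance in terms of the FIFTH joint cumulant along the tilt
(✓`TiltSecondOrder`'s shape one order up): for a finite measure `μ ≠ 0` and bounded measurable `U, G₁, G₂`,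
`|Cov₁(G₁,G₂) − Cov₀(G₁,G₂) − κ₃,₀(G₁,G₂,U) − κ₄,₀(G₁,G₂,U,U)/2| ≤ K/6` whenever `|κ₅,t(G₁,G₂,U,U,U)| ≤ K` on `[0,1]`. -/
def TiltThirdOrder : Prop :=
  ∀ (Ω : Type) [MeasurableSpace Ω] (μ : Measure Ω) [IsFiniteMeasure μ], μ ≠ 0 →
    ∀ U G₁ G₂ : Ω → ℝ, Measurable U → Measurable G₁ → Measurable G₂ → (∃ B : ℝ, ∀ x, |U x| ≤ B ∧ |G₁ x| ≤ B ∧ |G₂ x| ≤ B) →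
    ∀ K : ℝ, (∀ t ∈ Set.Icc (0 : ℝ) 1, |Tilt.tiltCum5 μ U t G₁ G₂| ≤ K) →
      |Tilt.tiltCov μ U 1 G₁ G₂ - Tilt.tiltCov μ U 0 G₁ G₂ - Tilt.tiltCum3 μ U 0 G₁ G₂ - Tilt.tiltCum4 μ U 0 G₁ G₂ / 2| ≤ K / 6

/-- ★★ **U5-L3 `tiltThirdOrder : TiltThirdOrder`**: `f(t) = Cov_t(G₁,G₂)` has `f′ = κ₃,t` (✓`Tilt.hasDerivAt_tiltCov`), `f″ = κ₄,t`
(✓`Tilt.hasDerivAt_tiltCum3`), `f‴ = κ₅,t` (`Tilt.hasDerivAt_tiltCum4`); Taylor to third order (`Tilt.abs_sub_sub_sub_le_of_third_deriv`). [folklore] -/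
theorem tiltThirdOrder : TiltThirdOrder := by
  intro Ω _ μ _ hμ U G₁ G₂ hU h₁ h₂ hB K hK
  obtain ⟨B, hB⟩ := hB
  haveI : NeZero μ := ⟨hμ⟩
  have hUb : ∀ x, |U x| ≤ B := fun x => (hB x).1
  have h₁b : ∀ x, |G₁ x| ≤ B := fun x => (hB x).2.1
  have h₂b : ∀ x, |G₂ x| ≤ B := fun x => (hB x).2.2
  exact Tilt.abs_sub_sub_sub_le_of_third_deriv (f := fun t => Tilt.tiltCov μ U t G₁ G₂) (f₁ := fun t => Tilt.tiltCum3 μ U t G₁ G₂)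
    (f₂ := fun t => Tilt.tiltCum4 μ U t G₁ G₂) (f₃ := fun t => Tilt.tiltCum5 μ U t G₁ G₂)
    (fun t => Tilt.hasDerivAt_tiltCov hU h₁ h₂ hUb h₁b h₂b t) (fun t => Tilt.hasDerivAt_tiltCum3 hU h₁ h₂ hUb h₁b h₂b t)
    (fun t => Tilt.hasDerivAt_tiltCum4 hU h₁ h₂ hUb h₁b h₂b t) hK

/-! Sanity: the two Props side by side. -/
example : TiltSecondOrder ∧ TiltThirdOrder := ⟨tiltSecondOrder, tiltThirdOrder⟩

end Summit.QuantumFields.YangMills.Theorems.AllWindowsColdBoxBoxHighLine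

end
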